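import Mathlib.LinearAlgebra.Basis.Basic
import Mathlib.LinearAlgebra.Quotient.Basic
import Mathlib.RingTheory.Ideal.Maps
import Mathlib.Algebra.Module.Submodule.Pointwise
import Mathlib.NumberTheory.Padics.RingHoms
import HarnessLib

/-!
# `N / aN ≅ (R/a)^ι` for a free module `N ≅ R^ι`, as a bijective semilinear map along `R → R/a`

Topic `Algebra/Module`; namespace `Literature.Algebra.Module`.
Definitions with bodies and theorems; no named fact, no `sorry`.

For a surjective ring map `τ : R → R'` with kernel `(a)` and a free `R`-module `N` with a finite
basis `b`:

* `coordSemimap τ b : N →ₛₗ[τ] (ι → R')`, `v ↦ (τ (b.repr v i))_i`, surjective, with kernel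
  `a N` (`coordSemimap_eq_zero_iff`);
* `quotSemimap τ a hker b : N ⧸ aN →ₛₗ[τ] (ι → R')`, **bijective** (`quotSemimap_bijective`);
* the case `R = ℤ_p`, `τ = toZModPow s`, `a = p^s` (`quotSemimapPadicInt_bijective`): a finitely
  generated free `ℤ_p`-module modulo `p^s` "is" the finite free `ℤ/p^s`-module `(ℤ/p^s)^ι` — the
  identification `ℳ_{ξ,K'}/p^m ≅ ⊕ ℤ/p^m` used in the proof of [Scholze2015, Thm. V.4.1].

## References

* N. Bourbaki, *Algèbre*, Ch. II §1 (free modules and quotients). [folklore]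
* P. Scholze, Ann. of Math. 182 (2015), §V.4, proof of Thm. V.4.1. [Scholze2015]
-/

noncomputable section

open scoped Pointwise

namespace Literature.Algebra.Module

variable {R R' : Type*} [CommRing R] [CommRing R'] (τ : R →+* R')
  {N : Type*} [AddCommGroup N] [Module R N] {ι : Type*} [Fintype ι] (b : Module.Basis ι R N)

/-- **Coordinates followed by `τ`**: `v ↦ (τ (b.repr v i))_i`, a `τ`-semilinear map `N → R'^ι`.
[folklore] -/
def coordSemimap : N →ₛₗ[τ] (ι → R') where
  toFun v := fun i => τ (b.repr v i)
  map_add' v w := funext fun i => by simp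
  map_smul' c v := funext fun i => by simp

omit [Fintype ι] in
/-- Unfolding lemma. [folklore] -/
@[simp]
theorem coordSemimap_apply (v : N) (i : ι) : coordSemimap τ b v i = τ (b.repr v i) :=
  rfl

/-- On a combination of the basis vectors the coordinates are read off. [folklore] -/
theorem coordSemimap_equivFun_symm (c : ι → R) (i : ι) :
    coordSemimap τ b (b.equivFun.symm c) i = τ (c i) := by
  rw [coordSemimap_apply, ← b.equivFun_apply, LinearEquiv.apply_symm_apply]

/-- `coordSemimap` is surjective when `τ` is. [folklore] -/
theorem coordSemimap_surjective (hτ : Function.Surjective τ) :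
    Function.Surjective (coordSemimap τ b) := fun g => by
  choose c hc using fun i => hτ (g i)
  exact ⟨b.equivFun.symm c, funext fun i => by rw [coordSemimap_equivFun_symm, hc]⟩

variable (a : R) (hker : RingHom.ker τ = Ideal.span {a})

/-- Membership in `aN = (a) • ⊤`. [folklore] -/
theorem mem_span_singleton_smul_top_iff (v : N) :
    v ∈ (Ideal.span {a} • ⊤ : Submodule R N) ↔ ∃ w : N, a • w = v := by
  rw [Submodule.ideal_span_singleton_smul, Submodule.mem_smul_pointwise_iff_exists]
  simp

include hker in
/-- **The kernel of `coordSemimap` is `aN`** (`ker τ = (a)`). [folklore] -/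
theorem coordSemimap_eq_zero_iff (v : N) :
    coordSemimap τ b v = 0 ↔ v ∈ (Ideal.span {a} • ⊤ : Submodule R N) := by
  rw [mem_span_singleton_smul_top_iff]
  constructor
  · intro h
    have hi : ∀ i, ∃ c : R, c * a = b.repr v i := fun i => by
      have h1 : b.repr v i ∈ RingHom.ker τ := by
        rw [RingHom.mem_ker, ← coordSemimap_apply τ b v i, h, Pi.zero_apply]
      rw [hker] at h1
      exact Ideal.mem_span_singleton'.1 h1
    choose c hc using hi
    refine ⟨b.equivFun.symm c, ?_⟩
    apply b.equivFun.injective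
    funext i
    rw [map_smul, LinearEquiv.apply_symm_apply, Pi.smul_apply, smul_eq_mul, mul_comm, hc,
      b.equivFun_apply]
  · rintro ⟨w, rfl⟩
    funext i
    rw [coordSemimap_apply, map_smul, Finsupp.smul_apply, smul_eq_mul, map_mul, Pi.zero_apply]
    have ha : τ a = 0 := by
      rw [← RingHom.mem_ker, hker]
      exact Ideal.mem_span_singleton_self a
    rw [ha, zero_mul]

include hker in
/-- `aN ≤ ker coordSemimap`. [folklore] -/
theorem span_singleton_smul_top_le_ker :
    (Ideal.span {a} • ⊤ : Submodule R N) ≤ LinearMap.ker (coordSemimap τ b) := fun v hv =>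
  (LinearMap.mem_ker).2 ((coordSemimap_eq_zero_iff τ b a hker v).2 hv)

/-- **`N / aN → R'^ι`**, the descent of `coordSemimap` to the quotient. [folklore] -/
def quotSemimap : (N ⧸ (Ideal.span {a} • ⊤ : Submodule R N)) →ₛₗ[τ] (ι → R') :=
  (Ideal.span {a} • ⊤ : Submodule R N).liftQ (coordSemimap τ b)
    (span_singleton_smul_top_le_ker τ b a hker)

/-- Unfolding lemma for `quotSemimap`. [folklore] -/
@[simp]
theorem quotSemimap_mk (v : N) :
    quotSemimap τ b a hker (Submodule.Quotient.mk v) = coordSemimap τ b v :=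
  rfl

/-- `quotSemimap` is injective. [folklore] -/
theorem quotSemimap_injective : Function.Injective (quotSemimap τ b a hker) := by
  intro x y h
  induction x using Submodule.Quotient.induction_on with
  | H v =>
    induction y using Submodule.Quotient.induction_on with
    | H w =>
      rw [quotSemimap_mk, quotSemimap_mk] at h
      rw [Submodule.Quotient.eq, ← coordSemimap_eq_zero_iff τ b a hker, map_sub, h, sub_self]

/-- `quotSemimap` is surjective when `τ` is. [folklore] -/
theorem quotSemimap_surjective (hτ : Function.Surjective τ) :
    Function.Surjective (quotSemimap τ b a hker) := fun g => by
  obtain ⟨v, hv⟩ := coordSemimap_surjective τ b hτ g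
  exact ⟨Submodule.Quotient.mk v, by rw [quotSemimap_mk, hv]⟩

/-- **`N / aN ≅ R'^ι` via `quotSemimap`** (bijective `τ`-semilinear map) for `τ : R ↠ R'` with
kernel `(a)` and `N` free with finite basis. [folklore] -/
theorem quotSemimap_bijective (hτ : Function.Surjective τ) :
    Function.Bijective (quotSemimap τ b a hker) :=
  ⟨quotSemimap_injective τ b a hker, quotSemimap_surjective τ b a hker hτ⟩

/-! ### The case `ℤ_p → ℤ/p^s` -/

section PadicInt

variable (p : ℕ) [Fact p.Prime] (s : ℕ) {M : Type*} [AddCommGroup M] [Module ℤ_[p] M]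
  {κ : Type*} [Fintype κ] (bM : Module.Basis κ ℤ_[p] M)

/-- `toZModPow s : ℤ_p → ℤ/p^s` is surjective. [folklore] -/
theorem toZModPow_surjective : Function.Surjective (PadicInt.toZModPow s : ℤ_[p] →+* ZMod (p ^ s)) :=
  ZMod.ringHom_surjective _

/-- **`M / p^s M ≅ (ℤ/p^s)^κ`** for a free `ℤ_p`-module `M` with finite basis: the bijective
`toZModPow s`-semilinear map `quotSemimap`. [cite: Scholze2015, §V.4 (proof of Thm. V.4.1)] -/
theorem quotSemimapPadicInt_bijective :
    Function.Bijective (quotSemimap (PadicInt.toZModPow s) bM ((p : ℤ_[p]) ^ s)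
      (PadicInt.ker_toZModPow s)) :=
  quotSemimap_bijective _ bM _ _ (toZModPow_surjective p s)

/-- The submodule `p^s M` written with the natural-number cast, as in `nsmulSubmodule (p^s)`.
[folklore] -/
theorem span_natCast_pow_smul_top :
    (Ideal.span {(((p ^ s : ℕ) : ℤ_[p]))} • ⊤ : Submodule ℤ_[p] M) =
      (Ideal.span {(p : ℤ_[p]) ^ s} • ⊤ : Submodule ℤ_[p] M) := by
  rw [Nat.cast_pow]

end PadicInt

end Literature.Algebra.Module
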